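import Mathlib
import HarnessLib
import Summits.NavierStokesRegularity.NavierStokesRegularity.Theorems.PoloidalWindowDoorPoloidalWindowRigidityQuadraticDoor
import Summits.NavierStokesRegularity.NavierStokesRegularity.Theorems.PoloidalWindowDoorPoloidalWindowRigidityClebsch
import Summits.NavierStokesRegularity.NavierStokesRegularity.Theorems.PoloidalWindowDoorPoloidalWindowRigidityConstantShearMeans

/-!
# The umbilic door: `v₂` has an ISOTROPIC horizontal Hessian on an open set of ONE slice ⇒ trivial

Seat ns-poloidal-K2-p2 g6 (stub-worker on crux K2 `PoloidalWindowRigidity` = stmt-NavierStokesRegularity-19708, line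
lrc-jet v5, research stub `stub_twisting`; item stmt-20428 `LrcModEntire`, stub `stub_twistingTH`).

In every exact differential elimination of the (TH) stratum «shear slope a function of (time, height)» run in the
cell (nsreg-p7 g10/g11 orderly / twisting / frame rankings; this seat's EVOLUTION ranking, memo TH-EVO-g6) the
Thomas case tree has an UMBILIC branch: the traceless horizontal Hessian of the vertical velocity vanishes,
`∂₀∂₀v₂ = ∂₁∂₁v₂`, `∂₀∂₁v₂ = 0` (nsreg-p7's leading-coefficient factor `(w_xx − w_yy)² + 4w_xy²` of law C7; the
spin-2 branch vector `Z = 6Λ²Λ′·w₂ + (Λ′² − 2ΛΛ″)·Φ₂` of the evolution ranking when `w₂ = 0`).  This is exactly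
where the two exact local (TH) families with `Λ_z ≠ 0` live (F1 planar constant vorticity, F2 generalised Hill:
`v₂ = k(z,t)|x_h − c|²/2 + m(z,t)`), so NO local certificate can close it — the CLASS must.  This file is the class
door for that branch, a two-line corollary of ns-poloidal-K2-p2 g4's quadratic door
(`…QuadraticDoor.eq_zero_of_horizontalCubicFDeriv_eq_zero_on_open`):

* `fderiv_partial00_eq_zero_of_umbilic` — pointwise calculus: if on an open `U` the slice field `u ∈ C³` has
  `∂₀(∂₀u₂) = ∂₁(∂₁u₂)` and `∂₀(∂₁u₂) = 0`, then `∂₀(∂₀(∂₀u₂)) = 0` on `U` (differentiate the first identity along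
  `e₀`, commute `∂₀∂₁` on the `C²` function `∂₁u₂`, and differentiate the second identity along `e₁`);
* `eq_zero_of_umbilic_on_open` — **THE UMBILIC DOOR**: a profile of the route's Type-I class, poloidal along `e₃`
  on ONE slice `s < 0`, whose vertical velocity has isotropic horizontal Hessian on a non-empty open subset of that
  slice, vanishes identically;
* `nonflatLiouville_of_umbilic_on_open` — the same as «not a backward singular point».

WHAT THIS IS NOT: not a claim about Navier–Stokes regularity and not the stub — the class door that closes the
umbilic branch of the (TH) ∩ twisting case tree (bears_on LADDER-NS N0 via crux K2 = stmt-19708 / item 20428).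
-/

-- the summit and its single sub-problem share the name (CONVENTIONS §1)
set_option linter.dupNamespace false

namespace Summit.NavierStokesRegularity.NavierStokesRegularity.Theorems.PoloidalWindowDoorPoloidalWindowRigidityUmbilicDoor

open Set Function Filter Topology
open scoped RealInnerProductSpace InnerProductSpace
open Literature.Analysis Literature.Analysis.FluidPDE
open Summit.NavierStokesRegularity.NavierStokesRegularity.Theorems.PoloidalWindowDoorPoloidalWindowRigidityQuadraticDoor
open Summit.NavierStokesRegularity.NavierStokesRegularity.Theorems.PoloidalWindowDoorPoloidalWindowRigidityClebsch
open Summit.NavierStokesRegularity.NavierStokesRegularity.Theorems.PoloidalWindowDoorPoloidalWindowRigidityConstantShearMeans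

/-! ### Pointwise calculus: isotropic horizontal Hessian on an open set ⇒ vanishing third `e₀`-derivative -/

/-- **Umbilic ⇒ cubic-free along `e₀`.**  Let `u : ℝ³ → ℝ³` be `C³` and `U` open.  If on `U` the horizontal Hessian of
`u₂` is isotropic — `∂₀(∂₀u₂) = ∂₁(∂₁u₂)` and `∂₀(∂₁u₂) = 0`, all partials written as iterated directional `fderiv`s of
the coordinates of `Du(·)e_b` — then `∂₀(∂₀(∂₀u₂)) = 0` on `U`.  Proof: near `x ∈ U` the functions `∂₀(∂₀u₂)` and
`∂₁(∂₁u₂)` agree, so their `e₀`-derivatives at `x` agree; `∂₀(∂₁(∂₁u₂)) = ∂₁(∂₀(∂₁u₂))` by the symmetry of the second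
derivative of the `C²` function `∂₁u₂`; and `∂₀(∂₁u₂)` vanishes near `x`, so its `e₁`-derivative at `x` is `0`. [folklore] -/
theorem fderiv_partial00_eq_zero_of_umbilic {u : EuclideanSpace ℝ (Fin 3) → EuclideanSpace ℝ (Fin 3)}
    (hu : ContDiff ℝ 3 u) {U : Set (EuclideanSpace ℝ (Fin 3))} (hU : IsOpen U)
    (hiso : ∀ x ∈ U,
      fderiv ℝ (fun y => fderiv ℝ u y (EuclideanSpace.single 0 (1 : ℝ)) 2) x (EuclideanSpace.single 0 (1 : ℝ)) =
        fderiv ℝ (fun y => fderiv ℝ u y (EuclideanSpace.single 1 (1 : ℝ)) 2) x (EuclideanSpace.single 1 (1 : ℝ)))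
    (hmix : ∀ x ∈ U,
      fderiv ℝ (fun y => fderiv ℝ u y (EuclideanSpace.single 1 (1 : ℝ)) 2) x (EuclideanSpace.single 0 (1 : ℝ)) = 0)
    {x : EuclideanSpace ℝ (Fin 3)} (hx : x ∈ U) :
    fderiv ℝ (fun y => fderiv ℝ (fun y' => fderiv ℝ u y' (EuclideanSpace.single 0 (1 : ℝ)) 2) y
      (EuclideanSpace.single 0 (1 : ℝ))) x (EuclideanSpace.single 0 (1 : ℝ)) = 0 := by
  set e₀ : EuclideanSpace ℝ (Fin 3) := EuclideanSpace.single 0 (1 : ℝ) with he₀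
  set e₁ : EuclideanSpace ℝ (Fin 3) := EuclideanSpace.single 1 (1 : ℝ) with he₁
  -- the first partial `g := ∂₁u₂` as a scalar function, and its regularity
  set g : EuclideanSpace ℝ (Fin 3) → ℝ := fun y => fderiv ℝ u y e₁ 2 with hg
  have hu2 : ContDiff ℝ 3 (fun y => u y 2) := contDiff_coord hu 2
  have hud : Differentiable ℝ u := hu.differentiable (by norm_num)
  have hg' : g = fun y => fderiv ℝ (fun y' => u y' 2) y e₁ := by
    funext y
    rw [hg]
    exact (fderiv_coord_apply (hud y) 2 e₁).symm
  have hgc : ContDiff ℝ 2 g := by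
    rw [hg']
    exact (hu2.fderiv_right (m := 2) (by norm_num)).clm_apply contDiff_const
  -- (1) `∂₀(∂₀∂₀u₂)(x) = ∂₀(∂₁∂₁u₂)(x)`: the two inner functions agree near `x`
  have hloc : (fun y => fderiv ℝ (fun y' => fderiv ℝ u y' e₀ 2) y e₀) =ᶠ[𝓝 x]
      fun y => fderiv ℝ g y e₁ := by
    filter_upwards [hU.mem_nhds hx] with y hy
    exact hiso y hy
  rw [hloc.fderiv_eq]
  -- (2) symmetry of the mixed partials of the `C²` function `g`
  rw [fderiv_fderiv_symm hgc x e₁ e₀]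
  -- (3) `∂₀ g` vanishes near `x`, hence so does its `e₁`-derivative at `x`
  have hloc2 : (fun y => fderiv ℝ g y e₀) =ᶠ[𝓝 x] fun _ => (0 : ℝ) := by
    filter_upwards [hU.mem_nhds hx] with y hy
    exact hmix y hy
  rw [hloc2.fderiv_eq, fderiv_fun_const]
  rfl

/-! ### The door in the class -/

variable {C : ℝ} {v : ℝ → EuclideanSpace ℝ (Fin 3) → EuclideanSpace ℝ (Fin 3)}

/-- **THE UMBILIC DOOR.**  A profile of the route's Type-I class (Type-I time decay, continuous on the backward slab,
Oseen-mild, divergence-free), poloidal along `e₃` on ONE slice `s < 0`, whose vertical velocity `v₂(s,·)` has an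
ISOTROPIC horizontal Hessian (`∂₀∂₀v₂ = ∂₁∂₁v₂` and `∂₀∂₁v₂ = 0`) on a non-empty open subset `U` of that slice, vanishes
identically on the backward slab.  (On `U`, `v₂(s,·)` restricted to horizontal planes is `a(x₂)|x_h|² + ` affine, in
particular cubic-free along `e₀`; the quadratic door of ns-poloidal-K2-p2 g4 concludes.)  This is the class closure of the
umbilic branch of the (TH) ∩ twisting case tree, the branch containing the exact local families F1/F2. -/
theorem eq_zero_of_umbilic_on_open (hrate : HasTypeITimeDecay C v)
    (hcont : ContinuousOn (uncurry v) (Iio (0 : ℝ) ×ˢ univ))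
    (hmild : ∀ s t : ℝ, s < t → t < 0 → ∀ x,
      v t x = UnboundedOperators.heatExtension (v s) (t - s) x - oseenDuhamel 1 s v v t x)
    (hdiv : ∀ t < 0, VectorCalculus.IsDivFree (v t)) {s : ℝ} (hs : s < 0)
    (hpol : ∀ y, ⟪curl (v s) y, EuclideanSpace.single 2 1⟫_ℝ = 0)
    {U : Set (EuclideanSpace ℝ (Fin 3))} (hU : IsOpen U) (hne : U.Nonempty)
    (hiso : ∀ x ∈ U,
      fderiv ℝ (fun y => fderiv ℝ (v s) y (EuclideanSpace.single 0 (1 : ℝ)) 2) x (EuclideanSpace.single 0 (1 : ℝ)) =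
        fderiv ℝ (fun y => fderiv ℝ (v s) y (EuclideanSpace.single 1 (1 : ℝ)) 2) x (EuclideanSpace.single 1 (1 : ℝ)))
    (hmix : ∀ x ∈ U,
      fderiv ℝ (fun y => fderiv ℝ (v s) y (EuclideanSpace.single 1 (1 : ℝ)) 2) x (EuclideanSpace.single 0 (1 : ℝ)) = 0) :
    ∀ t < 0, ∀ x, v t x = 0 := by
  have h3 : ContDiff ℝ 3 (v s) := (contDiff_slice hrate hcont hmild hs).of_le (by norm_cast)
  exact eq_zero_of_horizontalCubicFDeriv_eq_zero_on_open hrate hcont hmild hdiv hs hpol hU hne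
    fun x hx => fderiv_partial00_eq_zero_of_umbilic h3 hU hiso hmix hx

/-- **The umbilic door, «not backward-singular» form** (the currency of `stub_twisting` / `stub_twistingTH`). -/
theorem nonflatLiouville_of_umbilic_on_open (hrate : HasTypeITimeDecay C v)
    (hcont : ContinuousOn (uncurry v) (Iio (0 : ℝ) ×ˢ univ))
    (hmild : ∀ s t : ℝ, s < t → t < 0 → ∀ x,
      v t x = UnboundedOperators.heatExtension (v s) (t - s) x - oseenDuhamel 1 s v v t x)
    (hdiv : ∀ t < 0, VectorCalculus.IsDivFree (v t)) {s : ℝ} (hs : s < 0)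
    (hpol : ∀ y, ⟪curl (v s) y, EuclideanSpace.single 2 1⟫_ℝ = 0)
    {U : Set (EuclideanSpace ℝ (Fin 3))} (hU : IsOpen U) (hne : U.Nonempty)
    (hiso : ∀ x ∈ U,
      fderiv ℝ (fun y => fderiv ℝ (v s) y (EuclideanSpace.single 0 (1 : ℝ)) 2) x (EuclideanSpace.single 0 (1 : ℝ)) =
        fderiv ℝ (fun y => fderiv ℝ (v s) y (EuclideanSpace.single 1 (1 : ℝ)) 2) x (EuclideanSpace.single 1 (1 : ℝ)))
    (hmix : ∀ x ∈ U,
      fderiv ℝ (fun y => fderiv ℝ (v s) y (EuclideanSpace.single 1 (1 : ℝ)) 2) x (EuclideanSpace.single 0 (1 : ℝ)) = 0) :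
    ¬ IsBackwardSingularPoint v 0 := by
  have h3 : ContDiff ℝ 3 (v s) := (contDiff_slice hrate hcont hmild hs).of_le (by norm_cast)
  exact nonflatLiouville_of_horizontalCubicFDeriv_eq_zero_on_open hrate hcont hmild hdiv hs hpol hU hne
    fun x hx => fderiv_partial00_eq_zero_of_umbilic h3 hU hiso hmix hx

end Summit.NavierStokesRegularity.NavierStokesRegularity.Theorems.PoloidalWindowDoorPoloidalWindowRigidityUmbilicDoor
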